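import Summits.BirchSwinnertonDyer.Rank1Residual.X12.O11.RouteUMember11
import Summits.BirchSwinnertonDyer.Rank1Residual.X12.O11.RouteUMember23
import Summits.BirchSwinnertonDyer.Rank1Residual.X12.O11.RouteUMember43
import Literature.NumberTheory.EllipticCurves.Rank1Residual.X11RankOneCertificates.Minimality
import HarnessLib

/-!
# ROUTE U — the prime members on their EXPLICIT global minimal models (5929e1, 25921a1, 90601c1)

bsd-cm cell (run/shared/lean/pub/bsd-cm/), ROUTE U, seat `bsd-cm-ram`. The member theorems
`RouteU.forall_bsdp_of_twist_cm7_Dq` quantify over every globally minimal model `W` of `49a1^{(−q)}`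
with the data binder `hW : ∃ C, C • W = cm7.quadraticTwist (−q)`. Here that binder and the three
instances are DISCHARGED for the Cremona minimal models (a-invariants and the change of variables from
PARI `ellminimalmodel` applied to the tree's twist model `[0, −3D/4, 0, −2D², −D³]`, kit job j243970;
everything re-checked in the kernel: `IsElliptic` by `Δ ≠ 0`, `IsGloballyMinimal` by Silverman's integer
criterion `isGloballyMinimal_of_int_criterion` (`Δ = −7³q⁶`, no `ℓ¹² ∣ Δ`), `N ≠ 0` by
`conductorNorm_pos_holds`): for each label, **`forall_bsdp_<label>`** — Miller's `BSD(E, p)` at EVERY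
prime for THE curve `<label>`, displayed inputs = the member theorem's NAMED FACTS (12) + ANALYTIC
(`r_an = 1`, `L(E^{(−r)}, 1) ≠ 0`) + the remaining DATA (Heegner field/datum, parametrisation, Heegner
point, twin's minimal model, Mordell–Weil coordinate) + `7 ∤ c` (PRINT for these three conductors `≤ 130000`: Agashe–Ribet–Stein 2006 Thm 2.6;
planner ruling D62). THEOREMS ONLY (the instances are
`Prop`s registered as theorems); nothing booked.
References: [Cremona1997] Table 1 (labels); [SilvermanAEC2009] VII.1 Remark 1.1; [Miller2011LMS] Def. 1.1.
-/

noncomputable section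

open scoped Classical
open NumberField WeierstrassCurve DirichletCharacter
open Literature.NumberTheory.EllipticCurves Literature.NumberTheory.EllipticCurves.Rank1Residual
open Literature.NumberTheory.EllipticCurves.KrizLi2019 Literature.NumberTheory.LFunctions
open Literature.NumberTheory.EllipticCurves.ModularForms

namespace Summit.BirchSwinnertonDyer.Rank1Residual.X12.O11.RouteU

/-! ## `5929e1` = the global minimal model of `49a1^{(−11)}` -/

/-- `5929e1 = [1, -1, 1, -265, 2104]` is a model of `49a1^{(−11)}`: the change of variables
`[u, r, s, t] = [1, -3, 1/2, 1/2]` carries the tree's twist model `cm7.quadraticTwist (−11)` to it (PARI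
`ellminimalmodel`, kit j243970; re-checked here by `norm_num`). [cite: Cremona1997, Table 1 (curve 5929e1)] -/
theorem exists_variableChange_c5929e1 :
    ∃ C : VariableChange ℚ, C • (⟨1, -1, 1, -265, 2104⟩ : WeierstrassCurve ℚ) = cm7.quadraticTwist ((-(11 : ℕ) : ℤ) : ℚ) := by
  refine ⟨(⟨1, -3, 1/2, 1/2⟩ : VariableChange ℚ)⁻¹, ?_⟩
  rw [inv_smul_eq_iff]
  ext <;> norm_num [cm7, quadraticTwist, WeierstrassCurve.variableChange_a₁,
    WeierstrassCurve.variableChange_a₂, WeierstrassCurve.variableChange_a₃,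
    WeierstrassCurve.variableChange_a₄, WeierstrassCurve.variableChange_a₆, WeierstrassCurve.b₂,
    WeierstrassCurve.b₄, WeierstrassCurve.b₆]

/-- `5929e1` is an elliptic curve (`Δ = −7³·11⁶ ≠ 0`). [cite: Cremona1997, Table 1 (curve 5929e1)] -/
@[instance] theorem isElliptic_c5929e1 : (⟨1, -1, 1, -265, 2104⟩ : WeierstrassCurve ℚ).IsElliptic :=
  ⟨by
    rw [isUnit_iff_ne_zero]
    norm_num [WeierstrassCurve.Δ, WeierstrassCurve.b₂, WeierstrassCurve.b₄, WeierstrassCurve.b₆,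
      WeierstrassCurve.b₈]⟩

/-- `5929e1 = [1, -1, 1, -265, 2104]` is a GLOBAL MINIMAL model (`Δ = -607645423 = −7³·11⁶`: no prime
`ℓ` has `ℓ¹² ∣ Δ`; Silverman's integer criterion). [cite: SilvermanAEC2009, VII.1 Remark 1.1] -/
@[instance] theorem isGloballyMinimal_c5929e1 : (⟨1, -1, 1, -265, 2104⟩ : WeierstrassCurve ℚ).IsGloballyMinimal := by
  have h := Rank1Residual.X11RankOneCertificates.isGloballyMinimal_of_int_criterion 1 (-1) 1 (-265) 2104
    fun q hq ⟨hΔ, _⟩ => by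
      have hD : Rank1Residual.X11RankOneCertificates.discOf [1, -1, 1, -265, 2104] = -607645423 := by
        decide +kernel
      rw [hD, dvd_neg] at hΔ
      have hle : (q : ℤ) ^ 12 ≤ 607645423 := Int.le_of_dvd (by norm_num) hΔ
      have hqP : q < 7 := by
        by_contra h
        push Not at h
        have : (7 : ℤ) ^ 12 ≤ (q : ℤ) ^ 12 := by gcongr; exact_mod_cast h
        norm_num at this
        omega
      interval_cases q <;> (try norm_num at hq) <;> (try norm_num at hΔ)
  exact_mod_cast h

/-- `N(5929e1) ≠ 0`. [folklore] -/
@[instance] theorem neZero_conductorNorm_c5929e1 : NeZero ((⟨1, -1, 1, -265, 2104⟩ : WeierstrassCurve ℚ).conductorNorm ℤ) :=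
  ⟨((⟨1, -1, 1, -265, 2104⟩ : WeierstrassCurve ℚ).conductorNorm_pos_holds).ne'⟩

/-- **FULL BSD for `5929e1`** (Miller's `BSD(E, p)` at EVERY prime `p`) — `RouteU.forall_bsdp_of_twist_cm7_D11`
on the explicit minimal model, its model binder `hW` discharged by `exists_variableChange_c5929e1`; displayed:
the twelve named facts, `r_an = 1`, `L(5929e1^{(−19)}, 1) ≠ 0`, the Heegner field `K` (`d_K = −19`) with its
datum / parametrisation / Heegner point / `K ↪ ℚ₇`, the twin's minimal model, a Mordell–Weil coordinate over
`K`, and `7 ∤ c` (Manin constant; PRINT: Agashe–Ribet–Stein 2006 Thm 2.6, `N ≤ 130000`;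
also CERTIFIED-DATUM, lit W38 engine B). [cite: Miller2011LMS, §1 and Def. 1.1] [cite: KrizLi2019, Thm. 1.20 and Rem. 3.10] -/
theorem forall_bsdp_c5929e1
    (hKL : KrizLi2019.thm120_padicLogHeegner_unit_of_bernoulli)
    (hRem : KrizLi2019.rem310_padicLogHeegner_integral)
    (K : Type) [Field K] [NumberField K] [NeZero (NumberField.discr K).natAbs]
    (hK : IsImaginaryQuadratic K) (hdK : NumberField.discr K = -(19 : ℕ))
    (D : ModularParametrizationData (⟨1, -1, 1, -265, 2104⟩ : WeierstrassCurve ℚ) ((⟨1, -1, 1, -265, 2104⟩ : WeierstrassCurve ℚ).conductorNorm ℤ))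
    (H : HeegnerDatum ((⟨1, -1, 1, -265, 2104⟩ : WeierstrassCurve ℚ).conductorNorm ℤ) (NumberField.discr K)) (ι : K →+* ℂ) (ιp : K →+* ℚ_[7])
    (P : (((⟨1, -1, 1, -265, 2104⟩ : WeierstrassCurve ℚ)).baseChange K).toAffine.Point)
    (hGZ : gross_zagier ((⟨1, -1, 1, -265, 2104⟩ : WeierstrassCurve ℚ).conductorNorm ℤ) (⟨1, -1, 1, -265, 2104⟩ : WeierstrassCurve ℚ) K)
    (hKo : kolyvagin ((⟨1, -1, 1, -265, 2104⟩ : WeierstrassCurve ℚ).conductorNorm ℤ) (⟨1, -1, 1, -265, 2104⟩ : WeierstrassCurve ℚ) K)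
    (hGZK : rank_eq_analyticRank_of_analyticRank_le_one) (hmod : hasEntireLFunction_rat)
    (hP : WeierstrassCurve.Affine.Point.map ι.toRatAlgHom P = heegnerPointComplex D H)
    (hr1 : ((⟨1, -1, 1, -265, 2104⟩ : WeierstrassCurve ℚ)).analyticRank = 1)
    (hLt : (((⟨1, -1, 1, -265, 2104⟩ : WeierstrassCurve ℚ)).quadraticTwist (NumberField.discr K : ℚ)).entireLFunction 1 ≠ 0)
    (Wd : WeierstrassCurve ℚ) [Wd.IsElliptic] [Wd.IsGloballyMinimal] (Cd : VariableChange ℚ)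
    (hWd : Cd • ((⟨1, -1, 1, -265, 2104⟩ : WeierstrassCurve ℚ)).quadraticTwist (NumberField.discr K : ℚ) = Wd)
    (hBF : bsdTriple_of_hasCM_of_L_one_ne_zero)
    (hu : padicValRat 7 (Cd.u : ℚ) = 0)
    (hC : Rubin1983.thmC_seven_quadraticField)
    (hBG : BuhlerGross1985.firstDescent_seven_oddTwist_of_bernoulli)
    [Finite (AddCommGroup.torsion (((⟨1, -1, 1, -265, 2104⟩ : WeierstrassCurve ℚ)).baseChange K).toAffine.Point)]
    (crd : (((⟨1, -1, 1, -265, 2104⟩ : WeierstrassCurve ℚ)).baseChange K).toAffine.Point →+ ℤ) (g : (((⟨1, -1, 1, -265, 2104⟩ : WeierstrassCurve ℚ)).baseChange K).toAffine.Point)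
    (hg : crd g = 1) (hker : ∀ x, crd x = 0 → IsOfFinAddOrder x)
    (hc7 : ¬ ((7 : ℤ) ∣ D.c)) (hLLT : LiLiuTian2024.thm11_bsdp_of_cm_rank_one)
    (hKob : Kobayashi2013.cor14_bsdp_of_cm_rank_one) (hLTYZ : LiTianYanZhu2025.thm11_bsdp_of_cm_rank_one) :
    ∀ p : ℕ, p.Prime → BSDp (⟨1, -1, 1, -265, 2104⟩ : WeierstrassCurve ℚ) p :=
  forall_bsdp_of_twist_cm7_D11 hKL hRem _ exists_variableChange_c5929e1 K hK hdK D H ι ιp P hGZ hKo hGZK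
    hmod hP hr1 hLt Wd Cd hWd hBF hu hC hBG crd g hg hker hc7 hLLT hKob hLTYZ

/-! ## `25921a1` = the global minimal model of `49a1^{(−23)}` -/

/-- `25921a1 = [1, -1, 0, -1157, 18920]` is a model of `49a1^{(−23)}`: the change of variables
`[u, r, s, t] = [1, -6, 1/2, 0]` carries the tree's twist model `cm7.quadraticTwist (−23)` to it (PARI
`ellminimalmodel`, kit j243970; re-checked here by `norm_num`). [cite: Cremona1997, Table 1 (curve 25921a1)] -/
theorem exists_variableChange_c25921a1 :
    ∃ C : VariableChange ℚ, C • (⟨1, -1, 0, -1157, 18920⟩ : WeierstrassCurve ℚ) = cm7.quadraticTwist ((-(23 : ℕ) : ℤ) : ℚ) := by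
  refine ⟨(⟨1, -6, 1/2, 0⟩ : VariableChange ℚ)⁻¹, ?_⟩
  rw [inv_smul_eq_iff]
  ext <;> norm_num [cm7, quadraticTwist, WeierstrassCurve.variableChange_a₁,
    WeierstrassCurve.variableChange_a₂, WeierstrassCurve.variableChange_a₃,
    WeierstrassCurve.variableChange_a₄, WeierstrassCurve.variableChange_a₆, WeierstrassCurve.b₂,
    WeierstrassCurve.b₄, WeierstrassCurve.b₆]

/-- `25921a1` is an elliptic curve (`Δ = −7³·23⁶ ≠ 0`). [cite: Cremona1997, Table 1 (curve 25921a1)] -/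
@[instance] theorem isElliptic_c25921a1 : (⟨1, -1, 0, -1157, 18920⟩ : WeierstrassCurve ℚ).IsElliptic :=
  ⟨by
    rw [isUnit_iff_ne_zero]
    norm_num [WeierstrassCurve.Δ, WeierstrassCurve.b₂, WeierstrassCurve.b₄, WeierstrassCurve.b₆,
      WeierstrassCurve.b₈]⟩

/-- `25921a1 = [1, -1, 0, -1157, 18920]` is a GLOBAL MINIMAL model (`Δ = -50776309927 = −7³·23⁶`: no prime
`ℓ` has `ℓ¹² ∣ Δ`; Silverman's integer criterion). [cite: SilvermanAEC2009, VII.1 Remark 1.1] -/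
@[instance] theorem isGloballyMinimal_c25921a1 : (⟨1, -1, 0, -1157, 18920⟩ : WeierstrassCurve ℚ).IsGloballyMinimal := by
  have h := Rank1Residual.X11RankOneCertificates.isGloballyMinimal_of_int_criterion 1 (-1) 0 (-1157) 18920
    fun q hq ⟨hΔ, _⟩ => by
      have hD : Rank1Residual.X11RankOneCertificates.discOf [1, -1, 0, -1157, 18920] = -50776309927 := by
        decide +kernel
      rw [hD, dvd_neg] at hΔ
      have hle : (q : ℤ) ^ 12 ≤ 50776309927 := Int.le_of_dvd (by norm_num) hΔ
      have hqP : q < 11 := by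
        by_contra h
        push Not at h
        have : (11 : ℤ) ^ 12 ≤ (q : ℤ) ^ 12 := by gcongr; exact_mod_cast h
        norm_num at this
        omega
      interval_cases q <;> (try norm_num at hq) <;> (try norm_num at hΔ)
  exact_mod_cast h

/-- `N(25921a1) ≠ 0`. [folklore] -/
@[instance] theorem neZero_conductorNorm_c25921a1 : NeZero ((⟨1, -1, 0, -1157, 18920⟩ : WeierstrassCurve ℚ).conductorNorm ℤ) :=
  ⟨((⟨1, -1, 0, -1157, 18920⟩ : WeierstrassCurve ℚ).conductorNorm_pos_holds).ne'⟩

/-- **FULL BSD for `25921a1`** (Miller's `BSD(E, p)` at EVERY prime `p`) — `RouteU.forall_bsdp_of_twist_cm7_D23`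
on the explicit minimal model, its model binder `hW` discharged by `exists_variableChange_c25921a1`; displayed:
the twelve named facts, `r_an = 1`, `L(25921a1^{(−199)}, 1) ≠ 0`, the Heegner field `K` (`d_K = −199`) with its
datum / parametrisation / Heegner point / `K ↪ ℚ₇`, the twin's minimal model, a Mordell–Weil coordinate over
`K`, and `7 ∤ c` (Manin constant; PRINT: Agashe–Ribet–Stein 2006 Thm 2.6, `N ≤ 130000`;
also CERTIFIED-DATUM, lit W38 engine B). [cite: Miller2011LMS, §1 and Def. 1.1] [cite: KrizLi2019, Thm. 1.20 and Rem. 3.10] -/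
theorem forall_bsdp_c25921a1
    (hKL : KrizLi2019.thm120_padicLogHeegner_unit_of_bernoulli)
    (hRem : KrizLi2019.rem310_padicLogHeegner_integral)
    (K : Type) [Field K] [NumberField K] [NeZero (NumberField.discr K).natAbs]
    (hK : IsImaginaryQuadratic K) (hdK : NumberField.discr K = -(199 : ℕ))
    (D : ModularParametrizationData (⟨1, -1, 0, -1157, 18920⟩ : WeierstrassCurve ℚ) ((⟨1, -1, 0, -1157, 18920⟩ : WeierstrassCurve ℚ).conductorNorm ℤ))
    (H : HeegnerDatum ((⟨1, -1, 0, -1157, 18920⟩ : WeierstrassCurve ℚ).conductorNorm ℤ) (NumberField.discr K)) (ι : K →+* ℂ) (ιp : K →+* ℚ_[7])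
    (P : (((⟨1, -1, 0, -1157, 18920⟩ : WeierstrassCurve ℚ)).baseChange K).toAffine.Point)
    (hGZ : gross_zagier ((⟨1, -1, 0, -1157, 18920⟩ : WeierstrassCurve ℚ).conductorNorm ℤ) (⟨1, -1, 0, -1157, 18920⟩ : WeierstrassCurve ℚ) K)
    (hKo : kolyvagin ((⟨1, -1, 0, -1157, 18920⟩ : WeierstrassCurve ℚ).conductorNorm ℤ) (⟨1, -1, 0, -1157, 18920⟩ : WeierstrassCurve ℚ) K)
    (hGZK : rank_eq_analyticRank_of_analyticRank_le_one) (hmod : hasEntireLFunction_rat)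
    (hP : WeierstrassCurve.Affine.Point.map ι.toRatAlgHom P = heegnerPointComplex D H)
    (hr1 : ((⟨1, -1, 0, -1157, 18920⟩ : WeierstrassCurve ℚ)).analyticRank = 1)
    (hLt : (((⟨1, -1, 0, -1157, 18920⟩ : WeierstrassCurve ℚ)).quadraticTwist (NumberField.discr K : ℚ)).entireLFunction 1 ≠ 0)
    (Wd : WeierstrassCurve ℚ) [Wd.IsElliptic] [Wd.IsGloballyMinimal] (Cd : VariableChange ℚ)
    (hWd : Cd • ((⟨1, -1, 0, -1157, 18920⟩ : WeierstrassCurve ℚ)).quadraticTwist (NumberField.discr K : ℚ) = Wd)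
    (hBF : bsdTriple_of_hasCM_of_L_one_ne_zero)
    (hu : padicValRat 7 (Cd.u : ℚ) = 0)
    (hC : Rubin1983.thmC_seven_quadraticField)
    (hBG : BuhlerGross1985.firstDescent_seven_oddTwist_of_bernoulli)
    [Finite (AddCommGroup.torsion (((⟨1, -1, 0, -1157, 18920⟩ : WeierstrassCurve ℚ)).baseChange K).toAffine.Point)]
    (crd : (((⟨1, -1, 0, -1157, 18920⟩ : WeierstrassCurve ℚ)).baseChange K).toAffine.Point →+ ℤ) (g : (((⟨1, -1, 0, -1157, 18920⟩ : WeierstrassCurve ℚ)).baseChange K).toAffine.Point)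
    (hg : crd g = 1) (hker : ∀ x, crd x = 0 → IsOfFinAddOrder x)
    (hc7 : ¬ ((7 : ℤ) ∣ D.c)) (hLLT : LiLiuTian2024.thm11_bsdp_of_cm_rank_one)
    (hKob : Kobayashi2013.cor14_bsdp_of_cm_rank_one) (hLTYZ : LiTianYanZhu2025.thm11_bsdp_of_cm_rank_one) :
    ∀ p : ℕ, p.Prime → BSDp (⟨1, -1, 0, -1157, 18920⟩ : WeierstrassCurve ℚ) p :=
  forall_bsdp_of_twist_cm7_D23 hKL hRem _ exists_variableChange_c25921a1 K hK hdK D H ι ιp P hGZ hKo hGZK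
    hmod hP hr1 hLt Wd Cd hWd hBF hu hC hBG crd g hg hker hc7 hLLT hKob hLTYZ

/-! ## `90601c1` = the global minimal model of `49a1^{(−43)}` -/

/-- `90601c1 = [1, -1, 1, -4045, 122756]` is a model of `49a1^{(−43)}`: the change of variables
`[u, r, s, t] = [1, -11, 1/2, 1/2]` carries the tree's twist model `cm7.quadraticTwist (−43)` to it (PARI
`ellminimalmodel`, kit j243970; re-checked here by `norm_num`). [cite: Cremona1997, Table 1 (curve 90601c1)] -/
theorem exists_variableChange_c90601c1 :
    ∃ C : VariableChange ℚ, C • (⟨1, -1, 1, -4045, 122756⟩ : WeierstrassCurve ℚ) = cm7.quadraticTwist ((-(43 : ℕ) : ℤ) : ℚ) := by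
  refine ⟨(⟨1, -11, 1/2, 1/2⟩ : VariableChange ℚ)⁻¹, ?_⟩
  rw [inv_smul_eq_iff]
  ext <;> norm_num [cm7, quadraticTwist, WeierstrassCurve.variableChange_a₁,
    WeierstrassCurve.variableChange_a₂, WeierstrassCurve.variableChange_a₃,
    WeierstrassCurve.variableChange_a₄, WeierstrassCurve.variableChange_a₆, WeierstrassCurve.b₂,
    WeierstrassCurve.b₄, WeierstrassCurve.b₆]

/-- `90601c1` is an elliptic curve (`Δ = −7³·43⁶ ≠ 0`). [cite: Cremona1997, Table 1 (curve 90601c1)] -/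
@[instance] theorem isElliptic_c90601c1 : (⟨1, -1, 1, -4045, 122756⟩ : WeierstrassCurve ℚ).IsElliptic :=
  ⟨by
    rw [isUnit_iff_ne_zero]
    norm_num [WeierstrassCurve.Δ, WeierstrassCurve.b₂, WeierstrassCurve.b₄, WeierstrassCurve.b₆,
      WeierstrassCurve.b₈]⟩

/-- `90601c1 = [1, -1, 1, -4045, 122756]` is a GLOBAL MINIMAL model (`Δ = -2168227525807 = −7³·43⁶`: no prime
`ℓ` has `ℓ¹² ∣ Δ`; Silverman's integer criterion). [cite: SilvermanAEC2009, VII.1 Remark 1.1] -/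
@[instance] theorem isGloballyMinimal_c90601c1 : (⟨1, -1, 1, -4045, 122756⟩ : WeierstrassCurve ℚ).IsGloballyMinimal := by
  have h := Rank1Residual.X11RankOneCertificates.isGloballyMinimal_of_int_criterion 1 (-1) 1 (-4045) 122756
    fun q hq ⟨hΔ, _⟩ => by
      have hD : Rank1Residual.X11RankOneCertificates.discOf [1, -1, 1, -4045, 122756] = -2168227525807 := by
        decide +kernel
      rw [hD, dvd_neg] at hΔ
      have hle : (q : ℤ) ^ 12 ≤ 2168227525807 := Int.le_of_dvd (by norm_num) hΔ
      have hqP : q < 11 := by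
        by_contra h
        push Not at h
        have : (11 : ℤ) ^ 12 ≤ (q : ℤ) ^ 12 := by gcongr; exact_mod_cast h
        norm_num at this
        omega
      interval_cases q <;> (try norm_num at hq) <;> (try norm_num at hΔ)
  exact_mod_cast h

/-- `N(90601c1) ≠ 0`. [folklore] -/
@[instance] theorem neZero_conductorNorm_c90601c1 : NeZero ((⟨1, -1, 1, -4045, 122756⟩ : WeierstrassCurve ℚ).conductorNorm ℤ) :=
  ⟨((⟨1, -1, 1, -4045, 122756⟩ : WeierstrassCurve ℚ).conductorNorm_pos_holds).ne'⟩

/-- **FULL BSD for `90601c1`** (Miller's `BSD(E, p)` at EVERY prime `p`) — `RouteU.forall_bsdp_of_twist_cm7_D43`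
on the explicit minimal model, its model binder `hW` discharged by `exists_variableChange_c90601c1`; displayed:
the twelve named facts, `r_an = 1`, `L(90601c1^{(−19)}, 1) ≠ 0`, the Heegner field `K` (`d_K = −19`) with its
datum / parametrisation / Heegner point / `K ↪ ℚ₇`, the twin's minimal model, a Mordell–Weil coordinate over
`K`, and `7 ∤ c` (Manin constant; PRINT: Agashe–Ribet–Stein 2006 Thm 2.6, `N ≤ 130000`;
also CERTIFIED-DATUM, lit W38 engine B). [cite: Miller2011LMS, §1 and Def. 1.1] [cite: KrizLi2019, Thm. 1.20 and Rem. 3.10] -/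
theorem forall_bsdp_c90601c1
    (hKL : KrizLi2019.thm120_padicLogHeegner_unit_of_bernoulli)
    (hRem : KrizLi2019.rem310_padicLogHeegner_integral)
    (K : Type) [Field K] [NumberField K] [NeZero (NumberField.discr K).natAbs]
    (hK : IsImaginaryQuadratic K) (hdK : NumberField.discr K = -(19 : ℕ))
    (D : ModularParametrizationData (⟨1, -1, 1, -4045, 122756⟩ : WeierstrassCurve ℚ) ((⟨1, -1, 1, -4045, 122756⟩ : WeierstrassCurve ℚ).conductorNorm ℤ))
    (H : HeegnerDatum ((⟨1, -1, 1, -4045, 122756⟩ : WeierstrassCurve ℚ).conductorNorm ℤ) (NumberField.discr K)) (ι : K →+* ℂ) (ιp : K →+* ℚ_[7])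
    (P : (((⟨1, -1, 1, -4045, 122756⟩ : WeierstrassCurve ℚ)).baseChange K).toAffine.Point)
    (hGZ : gross_zagier ((⟨1, -1, 1, -4045, 122756⟩ : WeierstrassCurve ℚ).conductorNorm ℤ) (⟨1, -1, 1, -4045, 122756⟩ : WeierstrassCurve ℚ) K)
    (hKo : kolyvagin ((⟨1, -1, 1, -4045, 122756⟩ : WeierstrassCurve ℚ).conductorNorm ℤ) (⟨1, -1, 1, -4045, 122756⟩ : WeierstrassCurve ℚ) K)
    (hGZK : rank_eq_analyticRank_of_analyticRank_le_one) (hmod : hasEntireLFunction_rat)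
    (hP : WeierstrassCurve.Affine.Point.map ι.toRatAlgHom P = heegnerPointComplex D H)
    (hr1 : ((⟨1, -1, 1, -4045, 122756⟩ : WeierstrassCurve ℚ)).analyticRank = 1)
    (hLt : (((⟨1, -1, 1, -4045, 122756⟩ : WeierstrassCurve ℚ)).quadraticTwist (NumberField.discr K : ℚ)).entireLFunction 1 ≠ 0)
    (Wd : WeierstrassCurve ℚ) [Wd.IsElliptic] [Wd.IsGloballyMinimal] (Cd : VariableChange ℚ)
    (hWd : Cd • ((⟨1, -1, 1, -4045, 122756⟩ : WeierstrassCurve ℚ)).quadraticTwist (NumberField.discr K : ℚ) = Wd)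
    (hBF : bsdTriple_of_hasCM_of_L_one_ne_zero)
    (hu : padicValRat 7 (Cd.u : ℚ) = 0)
    (hC : Rubin1983.thmC_seven_quadraticField)
    (hBG : BuhlerGross1985.firstDescent_seven_oddTwist_of_bernoulli)
    [Finite (AddCommGroup.torsion (((⟨1, -1, 1, -4045, 122756⟩ : WeierstrassCurve ℚ)).baseChange K).toAffine.Point)]
    (crd : (((⟨1, -1, 1, -4045, 122756⟩ : WeierstrassCurve ℚ)).baseChange K).toAffine.Point →+ ℤ) (g : (((⟨1, -1, 1, -4045, 122756⟩ : WeierstrassCurve ℚ)).baseChange K).toAffine.Point)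
    (hg : crd g = 1) (hker : ∀ x, crd x = 0 → IsOfFinAddOrder x)
    (hc7 : ¬ ((7 : ℤ) ∣ D.c)) (hLLT : LiLiuTian2024.thm11_bsdp_of_cm_rank_one)
    (hKob : Kobayashi2013.cor14_bsdp_of_cm_rank_one) (hLTYZ : LiTianYanZhu2025.thm11_bsdp_of_cm_rank_one) :
    ∀ p : ℕ, p.Prime → BSDp (⟨1, -1, 1, -4045, 122756⟩ : WeierstrassCurve ℚ) p :=
  forall_bsdp_of_twist_cm7_D43 hKL hRem _ exists_variableChange_c90601c1 K hK hdK D H ι ιp P hGZ hKo hGZK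
    hmod hP hr1 hLt Wd Cd hWd hBF hu hC hBG crd g hg hker hc7 hLLT hKob hLTYZ

end Summit.BirchSwinnertonDyer.Rank1Residual.X12.O11.RouteU

end
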